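import Literature.Barriers.AnomalousDissipation.SingleShellEnstrophyBoundMean
import Literature.Analysis.FluidPDE.LongTimeAverageSubadditive
import HarnessLib

/-!
# Tran–Shepherd's shell constraint with injection defect, for an ARBITRARY steady force, at the
# Leray–Hopf level and in the long-time mean
(barrier-audit proof file next to `Literature/Barriers/AnomalousDissipation/GravestModeLaminarAttractor`;
Leray–Hopf companion of the Galerkin-level `GravestModeLaminarAttractorBandPincer`, and the
general-force extension of `SingleShellEnstrophyBound(Mean)`)

For 2-D Navier–Stokes on `𝕋²` with a steady force `g`, the enstrophy balance minus `λ ×` the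
energy balance reads, for EVERY level `λ > 0` and with the signed shell excess
`ξ = ‖∇u‖² - λ‖u‖²_{L²}` (Tran–Shepherd, Physica D 165 (2002) §4, eq. (ξ); Constantin–Foias–Manley,
Phys. Fluids 6 (1994) 427):

  `½ ξ' = -ν(‖Δu‖² - λ‖∇u‖²) - (Δg + λg, u) ≤ -νλ ξ - (Δg + λg, u)`,

the last step being the spectral core `‖Δu‖² + λ²‖u‖² ≥ 2λ‖∇u‖²`. The term
`-(Δg + λg, u) = (Ag - λg, u)` (`A = -Δ`) is the **injection defect**: it vanishes identically
when `g` is a Stokes eigenfunction of eigenvalue `λ` (single shell, the case of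
`SingleShellEnstrophyBound`), and for a band-limited `g` with Fourier support on levels
`4π²|k|² ≤ λ` it equals `∑_k (λ - 4π²|k|²)·(-Re⟨ĝ_k, û_k⟩)`, a nonnegatively weighted sum of the
NEGATIVE instantaneous works done by the flow against the LOWER forced shells (Tran–Shepherd's
"monoscale-like" forces are exactly those for which it is `≤ 0`).

This file proves, for every global Leray–Hopf solution (any datum, any momentum):

* `shellDefect_integral_le` — the integrated inequality for `L² ∩ H¹` data:
  `2νλ(∫₀ᵀ‖∇u‖² - λ∫₀ᵀ‖u‖²) ≤ ξ(0) - ξ(T) - 2∫₀ᵀ(Δg + λg, u)`;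
* `shellDefect_setIntegral_enstrophy_le` — `∫₀ᵀ‖∇u‖² ≤ λ∫₀ᵀ‖u‖² + (νλ)⁻¹∫₀ᵀ W + C` with the
  **negative-work rate** `W(t) = max(-(Δg + λg, u(t)), 0)` and `C` independent of `T`;
* `shellDefect_meanEnstrophy_le_of_H1`, `shellDefect_meanEnstrophy_le` — the long-time mean form
  `⟨‖∇u‖²⟩ ≤ λ⟨‖u‖²⟩ + (νλ)⁻¹⟨W⟩` (`limsup` means), first for `H¹` data, then for ALL `L²` data by
  restart at an `H¹` time and translation invariance of the three means.

Consequence (recorded for the crux `TwohalfdNeg` / the planar law `SubLogStrain` of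
`Summits/AnomalousDissipation`): along a bounded-energy family `ν_j → 0` under a band-limited
steady force, mean enstrophy `⟨‖∇u_j‖²⟩ ≫ 1` requires NEGATIVE mean work against the lower forced
shells of size `⟨W_j⟩ ≳ ν_j λ ⟨‖∇u_j‖²⟩`; in particular `⟨‖∇u_j‖²⟩ ≳ log²(1/ν_j)` needs
`⟨W_j⟩ ≳ ν_j λ log²(1/ν_j)` — budgets neither forbid nor produce it.

## References

* C. V. Tran, T. G. Shepherd, Physica D 165 (2002) 199–212, §1 and §4 (eq. (ξ), (constraint),
  monoscale-like forcing and its time-mean form). [`TranShepherd2002`]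
* P. Constantin, C. Foias, O. P. Manley, Phys. Fluids 6 (1994) 427–429. [`ConstantinFoiasManley1994`]
* A. Alexakis, C. R. Doering, Phys. Lett. A 359 (2006) 652–657, §4. [`AlexakisDoering2006PLA`]
* C. Foias, O. Manley, R. Rosa, R. Temam, *Navier–Stokes Equations and Turbulence*, CUP 2001,
  Ch. II Thm. 7.3–7.4, App. II.A (A.62), (A.65). [`FoiasManleyRosaTemam2001`]
-/

open MeasureTheory Set Filter Topology UnitAddTorus
open scoped ENNReal NNReal InnerProductSpace

noncomputable section

namespace Literature.Barriers.AnomalousDissipation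

open Literature.Analysis.FunctionSpaces Literature.Analysis.FunctionSpaces.Torus
open Literature.Analysis.FluidPDE Literature.Analysis.FluidPDE.Torus

section Planar

variable {ν : ℝ} {g u₀ : UnitAddTorus (Fin 2) → EuclideanSpace ℝ (Fin 2)}
  {u : ℝ → UnitAddTorus (Fin 2) → EuclideanSpace ℝ (Fin 2)}

/-! ### The defect pairing along a Leray–Hopf solution -/

/-- Pointwise: `(Δg + λg, v) = (Δg, v) + λ(g, v)` for an `L²` slice `v` and smooth `g`. [folklore] -/
theorem integral_inner_laplacian_add_smul (hg : IsSmooth g) (lam : ℝ)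
    {v : UnitAddTorus (Fin 2) → EuclideanSpace ℝ (Fin 2)} (hv : MemLp v 2 volume) :
    ∫ x, ⟪laplacian g x + lam • g x, v x⟫_ℝ =
      (∫ x, ⟪laplacian g x, v x⟫_ℝ) + lam * ∫ x, ⟪g x, v x⟫_ℝ := by
  have hvi : Integrable v volume := hv.integrable one_le_two
  have h1 : Integrable (fun x => ⟪laplacian g x, v x⟫_ℝ) volume := by
    have h := Literature.Analysis.FunctionSpaces.Torus.integrable_inner_of_continuous hvi hg.laplacian.continuous
    simpa only [real_inner_comm] using h
  have h2 : Integrable (fun x => ⟪g x, v x⟫_ℝ) volume := by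
    have h := Literature.Analysis.FunctionSpaces.Torus.integrable_inner_of_continuous hvi hg.continuous
    simpa only [real_inner_comm] using h
  rw [← integral_const_mul, ← integral_add h1 (h2.const_mul lam)]
  refine integral_congr_ae (ae_of_all _ fun x => ?_)
  show ⟪laplacian g x + lam • g x, v x⟫_ℝ = ⟪laplacian g x, v x⟫_ℝ + lam * ⟪g x, v x⟫_ℝ
  rw [inner_add_left, real_inner_smul_left]

/-- The defect pairing `t ↦ (Δg + λg, u(t))` of a global Leray–Hopf solution with a smooth steady
field is integrable on every `(0, T]`. [folklore] -/
theorem integrableOn_defect_of_isGlobalLerayHopf (hg : IsSmooth g) (lam : ℝ)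
    (hu : IsGlobalLerayHopf ν (fun _ => g) u₀ u) {T : ℝ} (hT : 0 < T) :
    IntegrableOn (fun t => ∫ x, ⟪laplacian g x + lam • g x, u t x⟫_ℝ) (Ioc 0 T) := by
  have hc : Continuous fun x => laplacian g x + lam • g x :=
    hg.laplacian.continuous.add (hg.continuous.const_smul lam)
  have h := (hu T hT).integrableOn_integral_inner hc
  rw [integrableOn_Ioc_iff_integrableOn_Ioo]
  refine h.congr_fun (fun t _ => ?_) measurableSet_Ioo
  exact integral_congr_ae (ae_of_all _ fun x => real_inner_comm _ _)

/-- A uniform bound on the defect pairing along a global Leray–Hopf solution with a mean-zero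
force: `|(Δg + λg, u(t))| ≤ K(1 + R)/2` for `t ≥ 0`, where `‖Δg + λg‖_∞ ≤ K` and
`sup_{t ≥ 0}‖u(t)‖₂² ≤ R` (`IsGlobalLerayHopf.exists_forall_integral_norm_sq_le_of_hasZeroMean`). [folklore] -/
theorem exists_forall_abs_defect_le_of_isGlobalLerayHopf (hν : 0 < ν) (hg : IsSmooth g)
    (hg0 : HasZeroMean g) (lam : ℝ) (hu : IsGlobalLerayHopf ν (fun _ => g) u₀ u) :
    ∃ B : ℝ, 0 ≤ B ∧ ∀ t, 0 ≤ t → |∫ x, ⟪laplacian g x + lam • g x, u t x⟫_ℝ| ≤ B := by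
  obtain ⟨R, hR⟩ := hu.exists_forall_integral_norm_sq_le_of_hasZeroMean hν (hg.memLp 2) hg0
  obtain ⟨K, hK0, hK⟩ := exists_nonneg_forall_norm_le_of_continuous
    (hg.laplacian.continuous.add (hg.continuous.const_smul lam))
  have hR0 : 0 ≤ R := (integral_nonneg fun x => sq_nonneg _).trans (hR 0 le_rfl)
  refine ⟨K * (2⁻¹ * (1 + R)), by positivity, fun t ht => ?_⟩
  have hmem : MemLp (u t) 2 volume := hu.memLp_two ht
  have h1 : |∫ x, ⟪u t x, laplacian g x + lam • g x⟫_ℝ| ≤ K * ∫ x, ‖u t x‖ :=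
    abs_integral_inner_le_of_norm_le (hmem.integrable one_le_two) hK
  have hcomm : (∫ x, ⟪laplacian g x + lam • g x, u t x⟫_ℝ) = ∫ x, ⟪u t x, laplacian g x + lam • g x⟫_ℝ :=
    integral_congr_ae (ae_of_all _ fun x => real_inner_comm _ _)
  rw [hcomm]
  refine h1.trans (mul_le_mul_of_nonneg_left ((integral_norm_le_of_memLp_two hmem).trans ?_) hK0)
  gcongr
  exact hR t ht

/-! ### The integrated constraint with defect for `L² ∩ H¹` data -/

/-- **Tran–Shepherd's shell constraint with injection defect, integrated, for every Leray–Hopf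
solution from an `L² ∩ H¹` datum and an ARBITRARY smooth steady force.** On `𝕋²`, for `ν > 0`,
a smooth divergence-free mean-zero steady force `g`, ANY level `λ > 0`, a datum `u₀ ∈ L²` of
finite enstrophy, weakly divergence free, and every global Leray–Hopf solution `u`: for `T > 0`,
`2νλ(∫₀ᵀ‖∇u‖² - λ∫₀ᵀ‖u‖²) ≤ (‖∇u₀‖² - λ‖u₀‖²) - (‖∇u(T)‖² - λ‖u(T)‖²) - 2∫₀ᵀ(Δg + λg, u)`.
Proof: the enstrophy balance `½‖∇u(T)‖² + ν∫₀ᵀ‖Δu‖² = ½‖∇u₀‖² - ∫₀ᵀ(Δg, u)` of every Leray–Hopf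
solution (`fmrt_enstrophy_balance_torus2_holds`) minus `λ ×` the energy equality
(`IsGlobalLerayHopf.energy_eq_two`), and `‖Δu‖² ≥ 2λ‖∇u‖² - λ²‖u‖²` a.e. in time
(`two_mul_mul_toReal_eGradNormSq_le`). The single-shell case (`Δg = -λg`, zero defect) is
`singleShell_shellExcess_integral_le`. [cite: TranShepherd2002, §4 eq. (ξ)] -/
theorem shellDefect_integral_le (hν : 0 < ν) (hg : IsSmooth g) (hgd : IsDivFree g)
    (hg0 : HasZeroMean g) {lam : ℝ} (hlam : 0 < lam)
    (hu₀ : MemLp u₀ 2 volume) (hG : eGradNormSq u₀ ≠ ⊤) (hdiv : IsWeaklyDivFree u₀)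
    (hu : IsGlobalLerayHopf ν (fun _ => g) u₀ u) {T : ℝ} (hT : 0 < T) :
    2 * ν * lam *
        ((∫ t in Ioc 0 T, (eGradNormSq (u t)).toReal) - lam * ∫ t in Ioc 0 T, ∫ x, ‖u t x‖ ^ 2) ≤
      ((eGradNormSq u₀).toReal - lam * ∫ x, ‖u₀ x‖ ^ 2) -
        ((eGradNormSq (u T)).toReal - lam * ∫ x, ‖u T x‖ ^ 2) -
        2 * ∫ t in Ioc 0 T, ∫ x, ⟪laplacian g x + lam • g x, u t x⟫_ℝ := by
  have hLH := hu T hT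
  -- the enstrophy balance of every Leray–Hopf solution (2-D uniqueness inside)
  obtain ⟨hH2, hbal⟩ := fmrt_enstrophy_balance_torus2_holds hν hg hgd hg0
    (memSobolev_one_complexify_of_eGradNormSq_ne_top hu₀ hG) hdiv hu
  have hb := hbal T hT
  -- the energy equality
  have he := IsGlobalLerayHopf.energy_eq_two hν.le hg hu₀ hu hT
  rw [kineticEnergy, kineticEnergy, ← (hu.integrableOn_toReal_eGradNormSq hT).2,
    intervalIntegral.integral_of_le hT.le] at he
  -- the defect splits
  have hDi : IntegrableOn (fun t => ∫ x, ⟪laplacian g x, u t x⟫_ℝ) (Ioc 0 T) := by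
    have h := integrableOn_defect_of_isGlobalLerayHopf hg 0 hu hT
    refine h.congr_fun (fun t _ => ?_) measurableSet_Ioc
    exact integral_congr_ae (ae_of_all _ fun x => by simp only [zero_smul, add_zero])
  have hGi : IntegrableOn (fun t => ∫ x, ⟪g x, u t x⟫_ℝ) (Ioc 0 T) := by
    have h := (hu T hT).integrableOn_integral_inner hg.continuous
    rw [integrableOn_Ioc_iff_integrableOn_Ioo]
    refine h.congr_fun (fun t _ => ?_) measurableSet_Ioo
    exact integral_congr_ae (ae_of_all _ fun x => real_inner_comm _ _)
  have hsplit : ∫ t in Ioc 0 T, ∫ x, ⟪laplacian g x + lam • g x, u t x⟫_ℝ =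
      (∫ t in Ioc 0 T, ∫ x, ⟪laplacian g x, u t x⟫_ℝ) + lam * ∫ t in Ioc 0 T, ∫ x, ⟪g x, u t x⟫_ℝ := by
    rw [← integral_const_mul, ← integral_add hDi (hGi.const_mul lam)]
    refine integral_congr_ae ?_
    filter_upwards [ae_restrict_mem measurableSet_Ioc] with t ht
    exact integral_inner_laplacian_add_smul hg lam (hu.memLp_two ht.1.le)
  rw [hsplit]
  -- the spectral core, a.e. in time, integrated
  have hZi := (hu.integrableOn_toReal_eGradNormSq hT).1
  have hPi := hLH.integrableOn_toReal_eLaplacianNormSq (hH2 T hT)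
  have hEi := hu.integrableOn_integral_norm_sq hT
  have hae : ∀ᵐ s ∂(volume.restrict (Ioc 0 T)), 2 * lam * (eGradNormSq (u s)).toReal ≤
      (eLaplacianNormSq (u s)).toReal + lam ^ 2 * ∫ x, ‖u s x‖ ^ 2 := by
    rw [← Measure.restrict_congr_set Ioo_ae_eq_Ioc]
    filter_upwards [hLH.ae_eLaplacianNormSq_lt_top (hH2 T hT), ae_restrict_mem measurableSet_Ioo]
      with s hs hsI
    exact two_mul_mul_toReal_eGradNormSq_le hlam.le (hu.memLp_two hsI.1.le) hs.ne
  have hs : 2 * lam * ∫ t in Ioc 0 T, (eGradNormSq (u t)).toReal ≤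
      (∫ t in Ioc 0 T, (eLaplacianNormSq (u t)).toReal) + lam ^ 2 * ∫ t in Ioc 0 T, ∫ x, ‖u t x‖ ^ 2 := by
    rw [← integral_const_mul, ← integral_const_mul, ← integral_add hPi (hEi.const_mul _)]
    exact integral_mono_ae (hZi.const_mul _) (hPi.add (hEi.const_mul _)) hae
  have hs' := mul_le_mul_of_nonneg_left hs hν.le
  have he' : lam * (2⁻¹ * (∫ x, ‖u T x‖ ^ 2) + ν * ∫ t in Ioc 0 T, (eGradNormSq (u t)).toReal) =
      lam * (2⁻¹ * (∫ x, ‖u₀ x‖ ^ 2) + ∫ t in Ioc 0 T, ∫ x, ⟪g x, u t x⟫_ℝ) := by rw [he]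
  nlinarith [hb, he', hs']

/-- **Mean enstrophy above `λ ×` the energy costs negative lower-shell work, in time integral
(`L² ∩ H¹` data).** Under the hypotheses of `shellDefect_integral_le` there is `C` (depending on
the solution, not on `T`) with, for every `T > 0`,
`∫₀ᵀ‖∇u‖² ≤ λ∫₀ᵀ‖u‖²_{L²} + (νλ)⁻¹∫₀ᵀ W + C`, `W(t) = max(-(Δg + λg, u(t)), 0)` the negative
part of the defect pairing (`C = (‖∇u₀‖² + λ sup_t‖u(t)‖²)/(2νλ)`, uniform `L²` bound of
Leray–Hopf solutions under a mean-zero force). [cite: TranShepherd2002, §4 (constraint) and closing paragraphs] -/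
theorem shellDefect_setIntegral_enstrophy_le (hν : 0 < ν) (hg : IsSmooth g) (hgd : IsDivFree g)
    (hg0 : HasZeroMean g) {lam : ℝ} (hlam : 0 < lam)
    (hu₀ : MemLp u₀ 2 volume) (hG : eGradNormSq u₀ ≠ ⊤) (hdiv : IsWeaklyDivFree u₀)
    (hu : IsGlobalLerayHopf ν (fun _ => g) u₀ u) :
    ∃ C : ℝ, ∀ T, 0 < T →
      ∫ t in Ioc 0 T, (eGradNormSq (u t)).toReal ≤
        lam * (∫ t in Ioc 0 T, ∫ x, ‖u t x‖ ^ 2) +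
          (ν * lam)⁻¹ * (∫ t in Ioc 0 T, max (-(∫ x, ⟪laplacian g x + lam • g x, u t x⟫_ℝ)) 0) + C := by
  obtain ⟨R, hR⟩ := hu.exists_forall_integral_norm_sq_le_of_hasZeroMean hν (hg.memLp 2) hg0
  refine ⟨((eGradNormSq u₀).toReal + lam * R) / (2 * ν * lam), fun T hT => ?_⟩
  have h := shellDefect_integral_le hν hg hgd hg0 hlam hu₀ hG hdiv hu hT
  have hRT := hR T hT.le
  have hE0 : 0 ≤ ∫ x, ‖u₀ x‖ ^ 2 := integral_nonneg fun _ => sq_nonneg _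
  have hZT : 0 ≤ (eGradNormSq (u T)).toReal := ENNReal.toReal_nonneg
  have hc : 0 < 2 * ν * lam := by positivity
  -- the defect is dominated by its negative part
  have hDi := integrableOn_defect_of_isGlobalLerayHopf hg lam hu hT
  have hW : -(∫ t in Ioc 0 T, ∫ x, ⟪laplacian g x + lam • g x, u t x⟫_ℝ) ≤
      ∫ t in Ioc 0 T, max (-(∫ x, ⟪laplacian g x + lam • g x, u t x⟫_ℝ)) 0 := by
    rw [← integral_neg]
    exact integral_mono hDi.neg hDi.neg.pos_part fun t => le_max_left _ _
  have hkey : 2 * ν * lam * ∫ t in Ioc 0 T, (eGradNormSq (u t)).toReal ≤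
      2 * ν * lam * (lam * ∫ t in Ioc 0 T, ∫ x, ‖u t x‖ ^ 2) +
        2 * (∫ t in Ioc 0 T, max (-(∫ x, ⟪laplacian g x + lam • g x, u t x⟫_ℝ)) 0) +
        ((eGradNormSq u₀).toReal + lam * R) := by
    nlinarith [h, hW, mul_nonneg hlam.le hE0, mul_le_mul_of_nonneg_left hRT hlam.le]
  have hrhs : lam * (∫ t in Ioc 0 T, ∫ x, ‖u t x‖ ^ 2) +
        (ν * lam)⁻¹ * (∫ t in Ioc 0 T, max (-(∫ x, ⟪laplacian g x + lam • g x, u t x⟫_ℝ)) 0) +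
        ((eGradNormSq u₀).toReal + lam * R) / (2 * ν * lam) =
      (2 * ν * lam * (lam * ∫ t in Ioc 0 T, ∫ x, ‖u t x‖ ^ 2) +
        2 * (∫ t in Ioc 0 T, max (-(∫ x, ⟪laplacian g x + lam • g x, u t x⟫_ℝ)) 0) +
        ((eGradNormSq u₀).toReal + lam * R)) / (2 * ν * lam) := by
    field_simp
  rw [hrhs, le_div_iff₀ hc]
  linarith [hkey]

/-! ### The long-time mean form -/

/-- **Mean form, `L² ∩ H¹` data**: `⟨‖∇u‖²⟩ ≤ λ⟨‖u‖²⟩ + (νλ)⁻¹⟨W⟩`, `W = max(-(Δg + λg, u), 0)`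
(`limsup` long-time means; the running means of the energy and of `W` are bounded because
`sup_t‖u(t)‖₂ < ∞` under a mean-zero force). [cite: TranShepherd2002, §4 closing paragraphs (time-mean form)] -/
theorem shellDefect_meanEnstrophy_le_of_H1 (hν : 0 < ν) (hg : IsSmooth g) (hgd : IsDivFree g)
    (hg0 : HasZeroMean g) {lam : ℝ} (hlam : 0 < lam)
    (hu₀ : MemLp u₀ 2 volume) (hG : eGradNormSq u₀ ≠ ⊤) (hdiv : IsWeaklyDivFree u₀)
    (hu : IsGlobalLerayHopf ν (fun _ => g) u₀ u) :
    longTimeAvgSup (fun t => (eGradNormSq (u t)).toReal) ≤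
      lam * meanEnergy u +
        (ν * lam)⁻¹ * longTimeAvgSup (fun t => max (-(∫ x, ⟪laplacian g x + lam • g x, u t x⟫_ℝ)) 0) := by
  obtain ⟨C, hC⟩ := shellDefect_setIntegral_enstrophy_le hν hg hgd hg0 hlam hu₀ hG hdiv hu
  obtain ⟨R, hR⟩ := hu.exists_forall_integral_norm_sq_le_of_hasZeroMean hν (hg.memLp 2) hg0
  obtain ⟨B, hB0, hB⟩ := exists_forall_abs_defect_le_of_isGlobalLerayHopf hν hg hg0 lam hu
  have hνl : 0 ≤ (ν * lam)⁻¹ := by positivity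
  set E : ℝ → ℝ := fun t => ∫ x, ‖u t x‖ ^ 2 with hE
  set W : ℝ → ℝ := fun t => max (-(∫ x, ⟪laplacian g x + lam • g x, u t x⟫_ℝ)) 0 with hW
  have hE0 : ∀ t, 0 ≤ E t := fun t => integral_nonneg fun _ => sq_nonneg _
  have hW0 : ∀ t, 0 ≤ W t := fun t => le_max_right _ _
  have hEi : ∀ T, 0 < T → IntegrableOn E (Ioc 0 T) := fun T hT => hu.integrableOn_integral_norm_sq hT
  have hWi : ∀ T, 0 < T → IntegrableOn W (Ioc 0 T) := fun T hT =>
    (integrableOn_defect_of_isGlobalLerayHopf hg lam hu hT).neg.pos_part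
  have hEb : IsBoundedUnder (· ≤ ·) atTop (timeMean E) :=
    hu.isBoundedUnder_timeMean_energy hν (hg.memLp 2) hg0
  have hWle : ∀ t, 0 < t → W t ≤ B := fun t ht =>
    max_le ((neg_le_abs _).trans (hB t ht.le)) hB0
  have hWb : IsBoundedUnder (· ≤ ·) atTop (timeMean W) :=
    isBoundedUnder_le_timeMean (C := B) fun t ht => by
      rw [abs_of_nonneg (hW0 t)]; exact hWle t ht
  -- fold `λE + (νλ)⁻¹W` into one nonnegative observable
  set F : ℝ → ℝ := fun t => lam * E t + (ν * lam)⁻¹ * W t with hF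
  have hF0 : ∀ t, 0 ≤ F t := fun t => add_nonneg (mul_nonneg hlam.le (hE0 t)) (mul_nonneg hνl (hW0 t))
  have hFi : ∀ T, 0 < T → IntegrableOn F (Ioc 0 T) := fun T hT =>
    ((hEi T hT).const_mul lam).add ((hWi T hT).const_mul _)
  have hFb : IsBoundedUnder (· ≤ ·) atTop (timeMean F) := by
    refine isBoundedUnder_le_timeMean (C := lam * R + (ν * lam)⁻¹ * B) fun t ht => ?_
    rw [abs_of_nonneg (hF0 t)]
    exact add_le_add (mul_le_mul_of_nonneg_left (hR t ht.le) hlam.le)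
      (mul_le_mul_of_nonneg_left (hWle t ht) hνl)
  have hcmp : ∀ T, 0 < T → ∫ t in Ioc 0 T, (eGradNormSq (u t)).toReal ≤ 1 * (∫ t in Ioc 0 T, F t) + C := by
    intro T hT
    rw [one_mul, hF, integral_add ((hEi T hT).const_mul lam) ((hWi T hT).const_mul _),
      integral_const_mul, integral_const_mul]
    exact hC T hT
  have h1 := longTimeAvgSup_le_mul_of_setIntegral_le zero_le_one (fun _ => ENNReal.toReal_nonneg)
    hF0 hFb hcmp
  rw [one_mul] at h1
  refine h1.trans ?_
  have h2 := longTimeAvgSup_add_le (f := fun t => lam * E t) (g := fun t => (ν * lam)⁻¹ * W t)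
    (fun t => mul_nonneg hlam.le (hE0 t)) (fun t => mul_nonneg hνl (hW0 t))
    (fun T hT => (hEi T hT).const_mul lam) (fun T hT => (hWi T hT).const_mul _)
    (isBoundedUnder_timeMean_const_mul hlam.le hEb) (isBoundedUnder_timeMean_const_mul hνl hWb)
  refine h2.trans_eq ?_
  rw [longTimeAvgSup_const_mul hlam.le, longTimeAvgSup_const_mul hνl, meanEnergy_eq_longTimeAvgSup]

/-- **Tran–Shepherd's constraint with injection defect, in the mean, for ALL `L²` data.** On
`𝕋²`, for `ν > 0`, a smooth divergence-free mean-zero steady force `g`, ANY `λ > 0` and EVERY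
global Leray–Hopf solution `u` from an arbitrary datum (any momentum):
`⟨‖∇u‖₂²⟩ ≤ λ⟨‖u‖₂²⟩ + (νλ)⁻¹ ⟨max(-(Δg + λg, u), 0)⟩`.
For a band-limited `g` with Fourier support on levels `4π²|k|² ≤ λ` the pairing
`-(Δg + λg, u) = ∑_k (λ - 4π²|k|²)·(-Re⟨ĝ_k, û_k⟩)` weighs the instantaneous NEGATIVE works against
the LOWER forced shells ("monoscale-like" forces, Tran–Shepherd 2002 §1/§4, have it `≤ 0`, whence
`⟨‖∇u‖²⟩ ≤ λ_max⟨‖u‖²⟩`); for a single shell it vanishes (`singleShell_meanEnstrophy_le`). Proof: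
restart at a time `s > 0` with `u(s) ∈ H¹` from which the energy inequality holds
(`IsGlobalLerayHopf.exists_isGlobalLerayHopf_translate`), apply the `H¹` form to `u(· + s)` and
use that none of the three means sees the translation (`longTimeAvgSup_comp_add_right`,
`IsGlobalLerayHopf.meanEnergy_translate`). [cite: TranShepherd2002, §4 closing paragraphs (time-mean form)] -/
theorem shellDefect_meanEnstrophy_le (hν : 0 < ν) (hg : IsSmooth g) (hgd : IsDivFree g)
    (hg0 : HasZeroMean g) {lam : ℝ} (hlam : 0 < lam) (hu : IsGlobalLerayHopf ν (fun _ => g) u₀ u) :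
    longTimeAvgSup (fun t => (eGradNormSq (u t)).toReal) ≤
      lam * meanEnergy u +
        (ν * lam)⁻¹ * longTimeAvgSup (fun t => max (-(∫ x, ⟪laplacian g x + lam • g x, u t x⟫_ℝ)) 0) := by
  obtain ⟨s, hs, hGs, hw⟩ := hu.exists_isGlobalLerayHopf_translate hg hν.le
  have h := shellDefect_meanEnstrophy_le_of_H1 hν hg hgd hg0 hlam (hu.memLp_two hs.le) hGs.ne
    hw.isWeaklyDivFree_datum hw
  rw [hu.meanEnergy_translate hs.le] at h
  have hZ : longTimeAvgSup (fun t => (eGradNormSq (u (t + s))).toReal) =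
      longTimeAvgSup (fun t => (eGradNormSq (u t)).toReal) :=
    longTimeAvgSup_comp_add_right (φ := fun t => (eGradNormSq (u t)).toReal)
      (fun _ => ENNReal.toReal_nonneg) hs.le
      (fun a b ha hab => intervalIntegrable_of_forall_integrableOn_Ioc
        (fun T hT => (hu.integrableOn_toReal_eGradNormSq hT).1) ha hab)
  have hW : longTimeAvgSup (fun t => max (-(∫ x, ⟪laplacian g x + lam • g x, u (t + s) x⟫_ℝ)) 0) =
      longTimeAvgSup (fun t => max (-(∫ x, ⟪laplacian g x + lam • g x, u t x⟫_ℝ)) 0) :=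
    longTimeAvgSup_comp_add_right
      (φ := fun t => max (-(∫ x, ⟪laplacian g x + lam • g x, u t x⟫_ℝ)) 0)
      (fun _ => le_max_right _ _) hs.le
      (fun a b ha hab => intervalIntegrable_of_forall_integrableOn_Ioc
        (fun T hT => (integrableOn_defect_of_isGlobalLerayHopf hg lam hu hT).neg.pos_part) ha hab)
  rwa [hZ, hW] at h

end Planar

end Literature.Barriers.AnomalousDissipation

end
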